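import Literature.AlgebraicGeometry.Resolution.GeneralizedStabilityHenselizedRational
import Literature.AlgebraicGeometry.Resolution.OstrowskiHenselian
import Literature.AlgebraicGeometry.Resolution.HenselizationDefectless
import HarnessLib

/-!
# The Lemma of Ostrowski (Kuhlmann 2010, §2.3 (9)) — discharge of `Kuhlmann2010OstrowskiLemma`

Topic: `Literature/AlgebraicGeometry/Resolution` (valued function fields). Sibling PROOFS file of
`GeneralizedStabilityHenselizedRational.lean`: it DISCHARGES the named fact
`Kuhlmann2010OstrowskiLemma` = the **Lemma of Ostrowski** as quoted by F.-V. Kuhlmann,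
*Elimination of ramification I: The generalized stability theorem*, Trans. AMS 362 (2010)
5697–5727 = arXiv:1003.5678, §2.3, (9):

> Assume that `(L|K,v)` is a finite extension and the extension of `v` from `K` to `L` is
> unique. Then the Lemma of Ostrowski says that `[L:K] = (vL:vK)·[Lv:Kv]·p^ν` with `ν ≥ 0`
> where `p` is the characteristic exponent of `Kv`, that is, `p = char Kv` if this is positive,
> and `p = 1` otherwise (cf. [En], [R]).

The source prints no proof ([En] = O. Endler, *Valuation theory*, 1972; [R] = P. Ribenboim,
*Théorie des valuations*, 1968). The proof assembled here:

1. **Reduction to a henselian base** (the classical degree formula behind [En] §17, PROVED in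
   `HenselizationDegree.lean` / `HenselizationDefectless.lean`): realise everything inside
   `Ω = L̄` with a valuation ring `V ⊇ O'` (Chevalley), `K₀ ≅ K` the image of `K`; since `O'` is
   the ONLY extension of `O' ∩ K`, the degree formula `∑_{O'} [K₀^h·ι_{O'}(L) : K₀^h] = [L : K]`
   (`sum_finrank_adjoin_eq_finrank`) has a single term, `[K₀^h·L : K₀^h] = [L : K]`, and
   `e(O'|K) f(O'|K) = e(V ∩ K₀^h·L | K₀^h) f(…)` (`ramificationIndex_mul_inertiaDegree_comap_eq`,
   through the immediateness of the henselization, Lemma 2.2). The henselization `K₀^h` is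
   henselian (`Kuhlmann2010HenselizationIsHenselian_holds`).
2. **Ostrowski over a henselian subfield of `(Ω, V)`**
   (`exists_relFinrank_eq_mul_pow_of_isHenselianField`, `OstrowskiHenselian.lean`, resting on
   `OstrowskiRamification.lean`, `OstrowskiPrimeDivisors.lean`, `OstrowskiGalois.lean`): the
   ramification lemma of Zariski–Samuel II, Ch. VI §12, Thm. 24, conjugation over a henselian
   field, the prime divisors of `e` and `f`, a Sylow-subgroup form of ZS VI §12, Thm. 25 and
   its Corollary ("`efg ∣ n` and `n/efg` is a power of `π`"), separable and purely inseparable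
   parts.

## Main result (PROVED)

* `Kuhlmann2010OstrowskiLemma_holds : Kuhlmann2010OstrowskiLemma`.

## Sources

* F.-V. Kuhlmann, Trans. AMS 362 (2010) = arXiv:1003.5678, §1.1, Lemma 2.2, Lemma 2.3,
  §2.3 (9). [Kuhlmann2010]
* O. Zariski, P. Samuel, *Commutative Algebra* II (1960), Ch. VI §12, Thm. 24, Thm. 25 and
  Corollary. [ZariskiSamuel1960]

No definition is introduced and no statement of `GeneralizedStabilityHenselizedRational.lean`
is touched.
-/

noncomputable section

open IsLocalRing

namespace Literature.AlgebraicGeometry.Resolution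

universe u

/-! ### Transport of `[N : M]`, `e`, `f` between an intermediate field and its subfield -/

section ToSubfield

variable {Ω : Type u} [Field Ω] (V : ValuationSubring Ω) {M : Subfield Ω}

/-- For an intermediate field `N₀` of `Ω|M`: `relFinrank M N₀ = [N₀ : M]`,
`relRamificationIndex V M N₀ = e(V ∩ N₀ | M)`, `relInertiaDegree V M N₀ = f(V ∩ N₀ | M)`
(transport along the identity `N₀ ≃ₐ[M] N₀.toSubfield`). [folklore] -/
theorem rel_toSubfield_eq (N₀ : IntermediateField M Ω) :
    relFinrank M N₀.toSubfield (le_toSubfield_of_intermediateField N₀) = Module.finrank M N₀ ∧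
      relRamificationIndex V M N₀.toSubfield (le_toSubfield_of_intermediateField N₀) =
        ramificationIndex M (V.comap (algebraMap N₀ Ω)) ∧
      relInertiaDegree V M N₀.toSubfield (le_toSubfield_of_intermediateField N₀) =
        inertiaDegree M (V.comap (algebraMap N₀ Ω)) := by
  letI : Algebra M N₀.toSubfield :=
    (Subfield.inclusion (le_toSubfield_of_intermediateField N₀)).toAlgebra
  let ψ : N₀ ≃+* N₀.toSubfield := (toSubfieldAlgEquiv N₀).toRingEquiv
  have hc : ∀ x : M, ψ (algebraMap M N₀ x) = algebraMap M N₀.toSubfield (RingEquiv.refl M x) :=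
    fun x => Subtype.ext rfl
  have hW : V.comap (algebraMap N₀ Ω) =
      (V.comap (algebraMap N₀.toSubfield Ω)).comap ψ.toRingHom := by
    ext z
    rfl
  refine ⟨?_, ?_, ?_⟩
  · unfold relFinrank
    symm
    exact Algebra.finrank_eq_of_equiv_equiv (RingEquiv.refl M) ψ (RingHom.ext fun x => (hc x).symm)
  · unfold relRamificationIndex
    exact (ramificationIndex_congr (RingEquiv.refl M) ψ hc hW).symm
  · unfold relInertiaDegree
    exact (inertiaDegree_congr (RingEquiv.refl M) ψ hc hW).symm

end ToSubfield

/-! ### The Lemma of Ostrowski -/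

/-- **The Lemma of Ostrowski** (F.-V. Kuhlmann 2010, §2.3 (9); [En] §20, [R]) — discharge of the
named fact `Kuhlmann2010OstrowskiLemma` (`GeneralizedStabilityHenselizedRational.lean`): for a
finite extension `L|K` and a valuation ring `O'` of `L` which is the ONLY valuation ring of `L`
over `O' ∩ K`, `[L : K] = e(O'|K)·f(O'|K)·p^ν` for some `ν`, `p` the characteristic exponent of
the residue field of `O' ∩ K`. PROVED: reduction to the henselization inside `Ω = L̄` (degree
formula with a single term, `e`, `f` unchanged; `HenselizationDegree.lean`,
`HenselizationDefectless.lean`) and Ostrowski's lemma over a henselian subfield of `(Ω, V)`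
(`exists_relFinrank_eq_mul_pow_of_isHenselianField`, `OstrowskiHenselian.lean`).
[cite: Kuhlmann2010, Section 2.3, (9)] -/
theorem Kuhlmann2010OstrowskiLemma_holds : Kuhlmann2010OstrowskiLemma.{u} := by
  intro K L _ _ _ hfin O' huniq
  classical
  haveI := hfin
  -- (1) the ambient algebraically closed valued field `(Ω, V)`, `V ⊇ O'`
  obtain ⟨V, hV⟩ := exists_valuationSubring_comap_eq (F := L) (Ω := AlgebraicClosure L) O'
  -- (2) `K₀ ≅ K`, the image of `K` in `Ω`; `L` as a `K₀`-algebra; the embedding `ι`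
  let K₀ : Subfield (AlgebraicClosure L) := (algebraMap K (AlgebraicClosure L)).fieldRange
  let ψ : K ≃+* K₀ := RingEquiv.ofBijective (algebraMap K (AlgebraicClosure L)).rangeRestrictField
    (algebraMap K (AlgebraicClosure L)).rangeRestrictField_bijective
  have hψ : ∀ k : K, ((ψ k : K₀) : AlgebraicClosure L) = algebraMap K (AlgebraicClosure L) k :=
    fun _ => rfl
  letI : Algebra K₀ L := ((algebraMap K L).comp ψ.symm.toRingHom).toAlgebra
  have halg : ∀ c : K₀, algebraMap K₀ L c = algebraMap K L (ψ.symm c) := fun _ => rfl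
  have halgψ : ∀ k : K, algebraMap K₀ L (ψ k) = algebraMap K L k := fun k => by
    rw [halg, ψ.symm_apply_apply]
  have hcomm : ∀ c : K₀, algebraMap L (AlgebraicClosure L) (algebraMap K₀ L c) =
      algebraMap K₀ (AlgebraicClosure L) c := fun c => by
    rw [halg, ← IsScalarTower.algebraMap_apply K L (AlgebraicClosure L), ← hψ,
      ψ.apply_symm_apply]
    rfl
  let ι : L →ₐ[K₀] AlgebraicClosure L := ⟨algebraMap L (AlgebraicClosure L), hcomm⟩
  have hι : V.comap ι.toRingHom = O' := hV
  haveI : FiniteDimensional K₀ L :=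
    Module.Finite.of_equiv_equiv ψ (RingEquiv.refl L) (RingHom.ext fun k => halgψ k)
  -- (3) `O'` is the only extension of `V ∩ K₀` to `L`
  have hO'K₀ : O'.comap (algebraMap K₀ L) = V.comap (algebraMap K₀ (AlgebraicClosure L)) := by
    ext c
    simp only [ValuationSubring.mem_comap]
    rw [← hV, ValuationSubring.mem_comap, hcomm]
  have hs : ∀ O'' : ValuationSubring L, O'' ∈ ({O'} : Finset (ValuationSubring L)) ↔
      O''.comap (algebraMap K₀ L) = V.comap (algebraMap K₀ (AlgebraicClosure L)) := by
    intro O''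
    rw [Finset.mem_singleton]
    constructor
    · rintro rfl
      exact hO'K₀
    · intro h''
      refine huniq O'' ?_
      ext k
      have := SetLike.ext_iff.mp (h''.trans hO'K₀.symm) (ψ k)
      simp only [ValuationSubring.mem_comap] at this ⊢
      rwa [halgψ] at this
  -- (4) the degree formula, with a single term: `[K₀^h·L : K₀^h] = [L : K₀]`
  let b := Module.finBasis K₀ L
  have hdeg := sum_finrank_adjoin_eq_finrank V K₀ b {O'} hs (fun _ => ι) fun O'' hO'' => by
    rw [Finset.mem_singleton] at hO''
    rw [hO'']
    exact hι
  rw [Finset.sum_singleton] at hdeg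
  set M : IntermediateField (henselization V K₀) (AlgebraicClosure L) :=
    IntermediateField.adjoin (henselization V K₀) (Set.range (ι ∘ b)) with hM
  haveI : FiniteDimensional (henselization V K₀) M := finiteDimensional_adjoin_henselization V K₀ b ι
  -- (5) `e f` unchanged
  have hef := ramificationIndex_mul_inertiaDegree_comap_eq V K₀
    Kuhlmann2010HenselizationImmediate_holds ι M (algHom_apply_mem_adjoin V K₀ b ι)
    (adjoin_toSubfield_le_henselization V K₀ b ι)
  rw [hι] at hef
  -- (6) Ostrowski over the henselian `K₀^h`
  have hle : henselization V K₀ ≤ M.toSubfield := le_toSubfield_of_intermediateField M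
  have hhens := Kuhlmann2010HenselizationIsHenselian_holds (AlgebraicClosure L) V K₀
  have hfinM : RelFinite (henselization V K₀) M.toSubfield hle := relFinite_toSubfield M
  obtain ⟨ν, hν⟩ := exists_relFinrank_eq_mul_pow_of_isHenselianField V hle hhens hfinM
  obtain ⟨h1, h2, h3⟩ := rel_toSubfield_eq V M
  rw [h1, h2, h3, ← hef, hdeg] at hν
  -- (7) back to `K`: `[L : K] = [L : K₀]`, `e`, `f` and `p` unchanged
  have hcK : ∀ x : K, (RingEquiv.refl L) (algebraMap K L x) = algebraMap K₀ L (ψ x) :=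
    fun x => (halgψ x).symm
  have hWK : O' = O'.comap (RingEquiv.refl L).toRingHom := by
    ext x
    rfl
  have heK := ramificationIndex_congr ψ (RingEquiv.refl L) hcK hWK
  have hfK := inertiaDegree_congr ψ (RingEquiv.refl L) hcK hWK
  have hnK : Module.finrank K L = Module.finrank K₀ L :=
    Algebra.finrank_eq_of_equiv_equiv ψ (RingEquiv.refl L) (RingHom.ext fun k => halgψ k)
  have hp : ringExpChar (ResidueField (O'.comap (algebraMap K L))) =
      ringExpChar (ResidueField V) := by
    have hp1 := ringExpChar_eq_of_ringHom (residueFieldHom K O')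
    have hp2 := ringExpChar_eq_of_ringHom (residueFieldHom L V)
    rw [hV] at hp2
    exact hp1.trans hp2
  refine ⟨ν, ?_⟩
  rw [hnK, heK, hfK, hp]
  exact hν

end Literature.AlgebraicGeometry.Resolution
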